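import Summits.QuantumFields.YangMills.Theorems.BalabanUVNodesN16
import HarnessLib

/-!
# Route «BalabanUVNodes» (cluster K4 «SpineRates»), Track-A DAG node N16 = NE3 — THE END OF RECORD WITH ITS RADIUS UNIFORM IN THE LETTERS:
# `∃ r > 0` depending on `(d, L, N, n)` ONLY, then `∀ g > 0, ∀ (b′, c′)` on the leaf lines, `∀ 0 < ε ≤ r, 0 ≤ s₁ ≤ r, 0 ≤ b ≤ ε∕2`:
# N05-interface ∧ N07-interface ⟹ `∃ C, NE3EnergyRateWCov d (sfClass d L N ε) L N b g C s₁ s₂ dom`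

Cell `pub-ymgap`, seat `pub-ymgap-dag-n16-a` (KNIT-BY-NAME, HUMAN RULING D-0062; chair R424 venue), generation 2, file 2.  `bears_on: R4∕N16`.  Filed
`--supports stmt-QuantumFields-19182` (`SpineGivenEndpoint`, K4).

WHY.  THE END of record of the ne3 lineage, `NE3.PairLandauB8EndSfClassHP.ne3EnergyRateWCov_sfClass_small_lineFree` (p396369; g0's `n16_of_inEdges` is its
`d = 4` instance), is stated as `∀ g > 0, ∀ b′ c′ (lines), ∃ r > 0, ∀ ε ≤ r …` — the radius `r` is bound AFTER the regularity letter `g` and the leaf letters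
`(b′, c′)`.  Its PROOF, however, takes `r` from `NE3.EndLinesNonVacuous.endLines_exists d L N _ K₀ K₁ _` with `K₀, K₁, CP` closed terms in `(d, L, N, card n)`
and the owner swarm's `(θ, εc)` (`ownerLines_exist d L (card n)`): `r` does not depend on `g, b′, c′` at all.  The knit of N16's DECL column
(`BalabanUVNodesN16Shape.ne3Shape_of_n16`, file 1 of this generation) needs the letters chosen AFTER the class radius `ε ≤ r` (its regularity letter is
`g = gradConst 4 c` with `c ≤ t ≤ 2^{-76}L^{-12}ε`, and N16's class letter `b ≤ ε∕2` must dominate the leaf letter), so the quantifier order matters: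
with `r` first, the regime of the composed knit (file 3) is PROVABLY jointly satisfiable.  THIS FILE re-issues the last four steps of THE END with the
quantifiers in the honest order — `∃ r > 0, ∀ g > 0, ∀ b′ c′, …` — by the SAME proofs (copied verbatim from the lineage's files, only the binders move):
* §1 `ne3EnergyRateWCov_sfClass_small_uniform` ← `NE3.EndLinesNonVacuous.ne3EnergyRateWCov_sfClass_small` (p-landed; THE END with its ≈ 35 numeric lines
  discharged; per-pair binders `hF5` ([B9] (3.42)∕(3.49) TYPE) and `hP` ((P♮) on `slicB8`) still displayed);
* §2 `ne3EnergyRateWCov_sfClass_small_of_leafH3sup_uniform` ← `NE3.PairLandauB8EndSfClassH3sup.ne3EnergyRateWCov_sfClass_small_of_leafH3sup` (`hF5` traded for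
  N07's interface (H3ˢᵘᵖ) `LeafH3sup d L N ε b′ c′ dom` + the two leaf lines);
* §3 `ne3EnergyRateWCov_sfClass_small_of_lines_uniform` ← `NE3.PairLandauB8EndSfClassHP.ne3EnergyRateWCov_sfClass_small_of_leafH3sup_of_lines` (`hP` PROVED under
  the owner's four k-free lines on `(θ, εc)`), `ne3EnergyRateWCov_sfClass_small_lineFree_uniform` ← `…_lineFree` (the four lines satisfiable);
* §4 `n16_of_inEdges_uniform` — the `d = 4` instance: g0's `n16_of_inEdges` with `∃ r` FIRST.

HONEST FRAMING.  Bookkeeping: the lineage's proofs re-run with binders reordered; no new estimate; the two in-edge interfaces `PairLandauGaugeB8Avg`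
([Balaban1985RegularSpaces] Thm 2 (1.36)–(1.39) pp. 82–83 + (1.37), read at the minimiser pair) and `LeafH3sup` ([Balaban1985Variational] Thm 1 (8)+(10)
p. 279) remain HYPOTHESIS SHAPES, NOT proved on the lattice; **N16 ∕ NE3 is NOT discharged**; NODE 00 has not pinned NE3's carriers; one finite
four-torus at fixed ε — NOT ℝ⁴, NOT infinite volume, NOT OS, NOT a mass gap, NOT Clay.
-/

set_option autoImplicit false

open scoped BigOperators Matrix Matrix.Norms.L2Operator
open NormedSpace Finset

namespace Summit.QuantumFields.YangMills.BalabanUVNodes.N16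

open Set
open Literature.MathematicalPhysics.QuantumFieldTheory.Balaban1983to89
open B7Prop1Explicit B7Prop2Explicit B7Prop3Flat MatrixLog
open T4AveragingDeficitWall (IsSkewDir IsUnitaryCfg SmallField Plane)
open T4AveragingDeficitWallBoundary (IsPeriodicCfg periodBox)
open Summit.QuantumFields.BalabanUV.T4Continuum
open AveragingDeficitPeriodicCounting (IsPeriodicDir)
open AveragingDeficitChartCalculus (cavg)
open AveragingDeficitMultiLevelPrep (LevelSmall)
open AveragingDeficitTwoLevelPrep (twoLevelSmall)
open MinimalActionSandwich (IsMinimiser)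
open MinimalActionRate (Regular sfClass)
open MinimalActionRefine (RegularSup)
open BlockAverageCurrent (curConst curConst_nonneg)
open NE3EnergyWeightedCovShape (NE3EnergyRateWCov)
open NE3SlicePoincareShape (SlicePoincare)
open NE3EnergyRateWSupOfSlicePoincare (cLambda cLambda_pos)
open NE3LinearNormalPartPreSizes (LocalSupMajorant)
open NE3QbarIterCovLiftPrep (cruxC liftC liftC_nonneg)
open NE3RightInverseSolveLetters (thetaLoc cruxC_nonneg)
open NE3RightInverseSupLetters (frameC)
open NE3SlicePoincareBudgetLine (CPLine ShLine SmallYLine)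
open NE3CovariantLineSumsL2 (C2sq)
open NE3CovariantLineSumsL2Tower (rho)
open NE3.PairLandauB8Avg (LandauRepB8Avg PairLandauGaugeB8Avg slicB8)
open NE3.LandauProjectionSupShape (LandauCorrectionSupB8)
open NE3.LeafIndexSockets (LeafH3sup)
open NE3.PairLandauB8EndSfClassTowers (ne3EnergyRateWCov_sfClass_towers)
open NE3.EndLinesNonVacuous (endLines_exists)
open NE3.PairLandauB8EndSupFacts (cruxC_eps_le_half supFacts_const_le)
open NE3.SupRegularityCurvedUniform (one_le_frameC_add)
open NE3.PairLandauB8EndSfClassH3sup (hF5_of_leafH3sup)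
open NE3.SlicePoincareCoulombN (CPLine_nonneg)
open NE3.PairLandauB8EndSfClassHP (slicePoincare_slicB8_cavg_of_regular ownerLines_exist)

noncomputable section

variable {d : ℕ} {n : Type*} [Fintype n] [DecidableEq n]

/-! ## §1 THE END with its numeric lines discharged — `r` before `g` -/

/-- **THE END ON B8's SURFACE OVER `sfClass`, NUMERIC LINES DISCHARGED, `r` UNIFORM IN `g`** — verbatim
`NE3.EndLinesNonVacuous.ne3EnergyRateWCov_sfClass_small` with the binder `∀ g > 0` moved INSIDE `∃ r` (the radius comes from `endLines_exists d L N _ K₀ K₁ _`,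
which never sees `g`): for `3 ≤ d`, `2 ≤ L`, `1 ≤ N`, `CP, K₀, K₁ ≥ 0` there is `r > 0` such that for every `g > 0`, `0 < ε ≤ r`, `0 ≤ s₁ ≤ r`, `0 ≤ b ≤ ε∕2`:
`PairLandauGaugeB8Avg` ∧ per-pair `LandauCorrectionSupB8 (K₀, K₁)` ∧ per-pair (P♮) on `slicB8` ⟹ `∃ C, NE3EnergyRateWCov d (sfClass d L N ε) L N b g C s₁ s₂ dom`.
Same proof. [folklore] -/
theorem ne3EnergyRateWCov_sfClass_small_uniform [Nonempty n] {d : ℕ} (hd : 3 ≤ d) {L N : ℕ} [NeZero L] [NeZero N] (hL : 2 ≤ L) (hN : 1 ≤ N)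
    {CP K₀ K₁ : ℝ} (hCP : 0 ≤ CP) (hK₀ : 0 ≤ K₀) (hK₁ : 0 ≤ K₁) :
    ∃ r : ℝ, 0 < r ∧ ∀ ⦃g : ℝ⦄, 0 < g → ∀ ⦃ε s₁ b : ℝ⦄, 0 < ε → ε ≤ r → 0 ≤ s₁ → s₁ ≤ r → 0 ≤ b → b ≤ ε / 2 →
      ∀ (s₂ : ℝ) {dom : _root_.Set (Site d → Fin d → (Matrix n n ℂ)ˣ)},
        PairLandauGaugeB8Avg d (sfClass d L N ε) L N b g s₁ s₂ 1 dom →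
        (∀ j : ℕ, ∀ V ∈ dom, ∀ UB : Site d → Fin d → (Matrix n n ℂ)ˣ, IsMinimiser d (sfClass d L N ε) L N (j + 2) V UB → Regular d L N b g (j + 2) UB → ∀ (hWu : IsUnitaryCfg (cavg L UB)) (hx : 0 ≤ ε / ((L : ℝ) ^ (j + 1)) ^ 2) (hs : LevelSmall d L j (ε / ((L : ℝ) ^ (j + 1)) ^ 2)) (hWx : SmallField (cavg L UB) (ε / ((L : ℝ) ^ (j + 1)) ^ 2)) (hθ : cruxC d L * (((L : ℝ) ^ (j + 1)) ^ 2 * (ε / ((L : ℝ) ^ (j + 1)) ^ 2)) < 1), LandauCorrectionSupB8 hL j hWu hx hs hWx N hθ K₀ K₁) →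
        (∀ j : ℕ, ∀ V ∈ dom, ∀ UB : Site d → Fin d → (Matrix n n ℂ)ˣ, IsMinimiser d (sfClass d L N ε) L N (j + 2) V UB → Regular d L N b g (j + 2) UB → SlicePoincare L (j + 1) (cavg L UB) (slicB8 L N (j + 1) (cavg L UB)) CP (periodBox (N * L ^ (j + 1)))) →
        ∃ C : ℝ, NE3EnergyRateWCov d (sfClass d L N ε) L N b g C s₁ s₂ dom := by
  obtain ⟨r, hr0, hr⟩ := endLines_exists (n := n) d L N (le_trans (by norm_num) hL) K₀ K₁ hCP
  refine ⟨r, hr0, fun g hg ε s₁ b hε hεr hs₁ hs₁r hb hbh s₂ dom hB8 hF5 hP => ?_⟩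
  obtain ⟨α₀, P, Q, AN, Ac, ah, Λ, hbε, hε1, hbs, hbε', h1, h2, hθε, hθlε, hPsε, hα, hα3, hα4, hεα, hsmall, hc₃, hK, hS1, hP0, hQ0,
    hPl, hQl, hAN, hAc, hah, hlines₁, hlineJ, hlineN, hlineα, hlineαN, hρ, hlineΛ, hlineCP, hreg₁, hbudget⟩ :=
    hr hε hεr hs₁ hs₁r hb hbh
  exact ⟨_, ne3EnergyRateWCov_sfClass_towers hd hL hN hb hbε hε1 hg hbs hbε' h1 h2 hθε hθlε hPsε hα hα3 hα4 hεα hs₁ hsmall hc₃ hK hS1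
    hP0 hQ0 hPl hQl hK₀ hK₁ hCP hAN hAc hah hlines₁ hlineJ hlineN hlineα hlineαN hρ hlineΛ hlineCP hreg₁ hbudget hB8 hF5 hP⟩

/-! ## §2 `hF5` traded for N07's interface (H3ˢᵘᵖ) — `r` before `(g, b′, c′)` -/

/-- **THE END WITH THE SUP LETTER GONE, `r` UNIFORM IN `(g, b′, c′)`** — verbatim `NE3.PairLandauB8EndSfClassH3sup.ne3EnergyRateWCov_sfClass_small_of_leafH3sup`
with `∀ g > 0` and the leaf letters `0 ≤ b′, c′` + their two lines ((Rb) `2^15(d+1)²(d+4)²L²b′ ≤ 1`, `23040d⁴(frameC+d)³(c′ + curConst·b′²) ≤ 1`) moved INSIDE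
`∃ r` (the uniform majorants `K₀*`, `K₁*` are closed terms in `(d, L, N, card n)`; `CP ≥ 0` stays a parameter): `PairLandauGaugeB8Avg d (sfClass d L N ε) L N b g s₁ s₂ 1 dom`
∧ `LeafH3sup d L N ε b′ c′ dom` ∧ per-pair (P♮) on `slicB8` with constant `CP` ⟹ `∃ C, NE3EnergyRateWCov d (sfClass d L N ε) L N b g C s₁ s₂ dom`.  Same proof. [folklore] -/
theorem ne3EnergyRateWCov_sfClass_small_of_leafH3sup_uniform [Nonempty n] (hd : 3 ≤ d) {L N : ℕ} [NeZero L] [NeZero N] (hL : 2 ≤ L)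
    (hN : 1 ≤ N) {CP : ℝ} (hCP : 0 ≤ CP) :
    ∃ r : ℝ, 0 < r ∧ ∀ ⦃g b' c' : ℝ⦄, 0 < g → 0 ≤ b' → 0 ≤ c' →
      2 ^ 15 * ((d : ℝ) + 1) ^ 2 * ((d : ℝ) + 4) ^ 2 * (L : ℝ) ^ 2 * b' ≤ 1 →
      23040 * (d : ℝ) ^ 4 * (frameC d L + d) ^ 3 * (c' + curConst d L * b' ^ 2) ≤ 1 → ∀ ⦃ε s₁ b : ℝ⦄, 0 < ε → ε ≤ r → 0 ≤ s₁ → s₁ ≤ r → 0 ≤ b → b ≤ ε / 2 →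
      ∀ (s₂ : ℝ) {dom : _root_.Set (Site d → Fin d → (Matrix n n ℂ)ˣ)},
        PairLandauGaugeB8Avg d (sfClass d L N ε) L N b g s₁ s₂ 1 dom →
        LeafH3sup d L N ε b' c' dom →
        (∀ j : ℕ, ∀ V ∈ dom, ∀ UB : Site d → Fin d → (Matrix n n ℂ)ˣ, IsMinimiser d (sfClass d L N ε) L N (j + 2) V UB → Regular d L N b g (j + 2) UB →
          SlicePoincare L (j + 1) (cavg L UB) (slicB8 L N (j + 1) (cavg L UB)) CP (periodBox (N * L ^ (j + 1)))) →
        ∃ C : ℝ, NE3EnergyRateWCov d (sfClass d L N ε) L N b g C s₁ s₂ dom := by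
  have hd1 : 1 ≤ d := le_trans (by norm_num) hd
  -- the level-free constant and the uniform majorants `K₀*`, `K₁*` of `K₀(ε)`, `K₁(ε)`
  obtain ⟨cR, hcR⟩ : ∃ K : ℝ, K = 1 + 2 * (Fintype.card n : ℝ) * (64 * (d : ℝ) ^ 2 * N) ^ d + 27 * (Fintype.card n : ℝ) ^ 3 * (512 : ℝ) ^ d * (N : ℝ) ^ d := ⟨_, rfl⟩
  have hcR0 : 0 ≤ cR := by rw [hcR]; positivity
  have hF0 : 0 ≤ frameC d L + d := le_trans zero_le_one (one_le_frameC_add hd1 L)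
  obtain ⟨K₀s, hK₀s⟩ : ∃ K : ℝ, K = 2 * ((d : ℝ) * liftC d * (36 * d * (frameC d L + d) ^ 2) * cR * (6 + 2 * ((d : ℝ) + 1))) := ⟨_, rfl⟩
  obtain ⟨K₁s, hK₁s⟩ : ∃ K : ℝ, K = 2 * ((d : ℝ) * liftC d * (36 * d * (frameC d L + d)) * cR * (6 + 2 * ((d : ℝ) + 1))) := ⟨_, rfl⟩
  have hK₀ : 0 ≤ K₀s := by rw [hK₀s]; have := liftC_nonneg d; positivity
  have hK₁ : 0 ≤ K₁s := by rw [hK₁s]; have := liftC_nonneg d; positivity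
  obtain ⟨r, hr0, hr⟩ := ne3EnergyRateWCov_sfClass_small_uniform (n := n) hd hL hN (CP := CP) hCP hK₀ hK₁
  have hc := cruxC_nonneg d L
  have hρ0 : 0 < 1 / (2 * cruxC d L + 2) := by positivity
  have hd0 : (0 : ℝ) < d := by exact_mod_cast hd1
  have hF1 : (1 : ℝ) ≤ frameC d L + d := one_le_frameC_add hd1 L
  have hF2 : 0 < 23040 * (d : ℝ) ^ 4 * (frameC d L + d) ^ 2 := by positivity
  have hσ0 : 0 < 1 / (23040 * (d : ℝ) ^ 4 * (frameC d L + d) ^ 2) := by positivity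
  refine ⟨min r (min (1 / (2 * cruxC d L + 2)) (1 / (23040 * (d : ℝ) ^ 4 * (frameC d L + d) ^ 2))), lt_min hr0 (lt_min hρ0 hσ0),
    fun g b' c' hg hb' hc' hRb hcF ε s₁ b hε hεr hs₁ hs₁r hb hbh s₂ dom hB8 h3 hP => ?_⟩
  have hεr' : ε ≤ r := hεr.trans (min_le_left _ _)
  have hs₁r' : s₁ ≤ r := hs₁r.trans (min_le_left _ _)
  obtain ⟨hcε, hε1⟩ := cruxC_eps_le_half d L hε.le (hεr.trans ((min_le_right _ _).trans (min_le_left _ _)))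
  have hεF : 23040 * (d : ℝ) ^ 4 * (frameC d L + d) ^ 2 * ε ≤ 1 := by
    have h1 : ε ≤ 1 / (23040 * (d : ℝ) ^ 4 * (frameC d L + d) ^ 2) := hεr.trans ((min_le_right _ _).trans (min_le_right _ _))
    rw [le_div_iff₀ hF2] at h1; linarith
  -- `K(ε) ≤ K*`
  have hle₀ : (d : ℝ) * liftC d * (6 + 2 * ((d : ℝ) + 1) * ε) * (36 * d * (frameC d L + d) ^ 2)
        * (1 + 2 * (Fintype.card n : ℝ) * (64 * (d : ℝ) ^ 2 * N) ^ d + 27 * (Fintype.card n : ℝ) ^ 3 * (512 : ℝ) ^ d * (N : ℝ) ^ d) / (1 - cruxC d L * ε) ≤ K₀s := by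
    rw [← hcR, hK₀s]
    have hA : 0 ≤ (d : ℝ) * liftC d * (36 * d * (frameC d L + d) ^ 2) * cR := by have := liftC_nonneg d; positivity
    have key := supFacts_const_le d L hA hε.le hε1 hcε
    calc (d : ℝ) * liftC d * (6 + 2 * ((d : ℝ) + 1) * ε) * (36 * d * (frameC d L + d) ^ 2) * cR / (1 - cruxC d L * ε)
        = (d : ℝ) * liftC d * (36 * d * (frameC d L + d) ^ 2) * cR * (6 + 2 * ((d : ℝ) + 1) * ε) / (1 - cruxC d L * ε) := by ring
      _ ≤ 2 * ((d : ℝ) * liftC d * (36 * d * (frameC d L + d) ^ 2) * cR * (6 + 2 * ((d : ℝ) + 1))) := key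
  have hle₁ : (d : ℝ) * liftC d * (6 + 2 * ((d : ℝ) + 1) * ε) * (36 * d * (frameC d L + d))
        * (1 + 2 * (Fintype.card n : ℝ) * (64 * (d : ℝ) ^ 2 * N) ^ d + 27 * (Fintype.card n : ℝ) ^ 3 * (512 : ℝ) ^ d * (N : ℝ) ^ d) / (1 - cruxC d L * ε) ≤ K₁s := by
    rw [← hcR, hK₁s]
    have hA : 0 ≤ (d : ℝ) * liftC d * (36 * d * (frameC d L + d)) * cR := by have := liftC_nonneg d; positivity
    have key := supFacts_const_le d L hA hε.le hε1 hcε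
    calc (d : ℝ) * liftC d * (6 + 2 * ((d : ℝ) + 1) * ε) * (36 * d * (frameC d L + d)) * cR / (1 - cruxC d L * ε)
        = (d : ℝ) * liftC d * (36 * d * (frameC d L + d)) * cR * (6 + 2 * ((d : ℝ) + 1) * ε) / (1 - cruxC d L * ε) := by ring
      _ ≤ 2 * ((d : ℝ) * liftC d * (36 * d * (frameC d L + d)) * cR * (6 + 2 * ((d : ℝ) + 1))) := key
  exact hr hg hε hεr' hs₁ hs₁r' hb hbh s₂ hB8 (hF5_of_leafH3sup hd1 hL h3 hb' hc' hRb hεF hcF hle₀ hle₁) hP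

/-! ## §3 `hP` proved under the owner's four k-free lines; the lines satisfiable — `r` before `(g, b′, c′)` -/

/-- **THE END WITH THE SLICE-POINCARÉ BINDER GONE, `r` UNIFORM IN `(g, b′, c′)`** — verbatim
`NE3.PairLandauB8EndSfClassHP.ne3EnergyRateWCov_sfClass_small_of_leafH3sup_of_lines` (`3 ≤ d`, `2 ≤ L`, `1 ≤ N`; the owner swarm's four k-free lines on
`(θ, εc)`, `θ, εc > 0`) with `∀ g > 0, ∀ b′ c′ (lines)` moved INSIDE `∃ r` (all radii absorbed into `r` are closed terms in `(d, L, card n, θ, εc)`):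
`PairLandauGaugeB8Avg` ([B8] Thm 2 + (1.37) ∘ [B11] Thm 1 TYPE) ∧ `LeafH3sup d L N ε b′ c′ dom` ([B11] Thm 1 (8)+(10) TYPE) ⟹ `∃ C, NE3EnergyRateWCov …`.
Same proof. [folklore] -/
theorem ne3EnergyRateWCov_sfClass_small_of_lines_uniform [Nonempty n] (hd : 3 ≤ d) {L N : ℕ} [NeZero L] [NeZero N] (hL : 2 ≤ L) (hN : 1 ≤ N)
    {θ εc : ℝ} (hθ : 0 < θ) (hεc : 0 < εc)
    (h1 : ShLine d L (Fintype.card n) εc θ ≤ 1 / 2) (h2 : SmallYLine d L (Fintype.card n) εc θ ≤ 1 / 2)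
    (h3 : 68 / 3 * (((d : ℝ) + 1) * ((d : ℝ) + 4)) * C2sq d L * θ ≤ rho d L / 2)
    (h4 : 8 * d * (((d : ℝ) - 1) * θ) ^ 2
      + 2 * ((Fintype.card n : ℝ) * ((4 * (d : ℝ) ^ 2 + 272 * d * (((d : ℝ) + 1) * ((d : ℝ) + 4))) * θ) ^ 2) ≤ 1 / 2) :
    ∃ r : ℝ, 0 < r ∧ ∀ ⦃g b' c' : ℝ⦄, 0 < g → 0 ≤ b' → 0 ≤ c' →
      2 ^ 15 * ((d : ℝ) + 1) ^ 2 * ((d : ℝ) + 4) ^ 2 * (L : ℝ) ^ 2 * b' ≤ 1 →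
      23040 * (d : ℝ) ^ 4 * (frameC d L + d) ^ 3 * (c' + curConst d L * b' ^ 2) ≤ 1 →
      ∀ ⦃ε s₁ b : ℝ⦄, 0 < ε → ε ≤ r → 0 ≤ s₁ → s₁ ≤ r → 0 ≤ b → b ≤ ε / 2 →
      ∀ (s₂ : ℝ) {dom : _root_.Set (Site d → Fin d → (Matrix n n ℂ)ˣ)},
        PairLandauGaugeB8Avg d (sfClass d L N ε) L N b g s₁ s₂ 1 dom →
        LeafH3sup d L N ε b' c' dom →
        ∃ C : ℝ, NE3EnergyRateWCov d (sfClass d L N ε) L N b g C s₁ s₂ dom := by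
  have hd1 : 1 ≤ d := by omega
  have hd0 : (0 : ℝ) < d := by exact_mod_cast (show 0 < d by omega)
  have hL0 : (0 : ℝ) < L := by exact_mod_cast (show 0 < L by omega)
  have hd1r : (1 : ℝ) ≤ d := by exact_mod_cast hd1
  have hdm : (0 : ℝ) ≤ (d : ℝ) - 1 := by linarith
  -- the k-free slice constant
  obtain ⟨δW, hδW⟩ : ∃ D : ℝ, D = (2 + 32 * (8 * (Fintype.card n : ℝ) * d * (1 + 2 * (((d : ℝ) - 1) * θ)) ^ 2 * (2 * (8 : ℝ) ^ d) ^ 2))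
      * (8 * (Fintype.card n : ℝ) * d * (1 + 2 * (((d : ℝ) - 1) * θ)) ^ 2 * (2 * (8 : ℝ) ^ d) ^ 2) := ⟨_, rfl⟩
  have hδW0 : 0 ≤ δW := by
    rw [hδW]
    have : 0 ≤ 1 + 2 * (((d : ℝ) - 1) * θ) := by have := mul_nonneg hdm hθ.le; linarith
    positivity
  have hCPL : 0 ≤ CPLine d L (Fintype.card n) εc θ := CPLine_nonneg hd1 L (by positivity) hεc.le hθ.le
  obtain ⟨CP, hCP⟩ : ∃ C : ℝ, C = 4 * (Fintype.card n : ℝ) * (69 + 2 * δW) * CPLine d L (Fintype.card n) εc θ := ⟨_, rfl⟩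
  have hCP0 : 0 ≤ CP := by rw [hCP]; positivity
  obtain ⟨r, hr0, hr⟩ := ne3EnergyRateWCov_sfClass_small_of_leafH3sup_uniform (n := n) hd hL hN hCP0
  -- the ε-radii of the lines absorbed into `r`
  obtain ⟨A, hA⟩ : ∃ A : ℝ, A = 128 * (69 + 2 * δW) * CPLine d L (Fintype.card n) εc θ * (Fintype.card (Plane d) : ℝ) * (Fintype.card n : ℝ) := ⟨_, rfl⟩
  have hA0 : 0 ≤ A := by rw [hA]; positivity
  obtain ⟨B₁, hB₁⟩ : ∃ B : ℝ, B = 16 * (14464 * ((d : ℝ) + 1) ^ 2 * ((d : ℝ) + 4) ^ 2) := ⟨_, rfl⟩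
  have hB₁0 : 0 < B₁ := by rw [hB₁]; positivity
  obtain ⟨B₂, hB₂⟩ : ∃ B : ℝ, B = 2 * twoLevelSmall d L := ⟨_, rfl⟩
  have hB₂0 : 0 < B₂ := by rw [hB₂]; unfold twoLevelSmall; positivity
  obtain ⟨B₃, hB₃⟩ : ∃ B : ℝ, B = 512 * ((d : ℝ) + 1) * ((d : ℝ) + 4) * (L : ℝ) ^ 2 := ⟨_, rfl⟩
  have hB₃0 : 0 < B₃ := by rw [hB₃]; positivity
  obtain ⟨B₄, hB₄⟩ : ∃ B : ℝ, B = 226 * (8 * ((d : ℝ) + 1) * ((d : ℝ) + 4)) ^ 2 := ⟨_, rfl⟩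
  have hB₄0 : 0 < B₄ := by rw [hB₄]; positivity
  have hL2 : (0 : ℝ) < (L : ℝ) ^ 2 := by positivity
  refine ⟨min r (min θ (min (1 / (A + 1)) (min (3 / B₁) (min ((L : ℝ) ^ 2 / B₂) (min (1 / B₃) (2 / B₄)))))),
    lt_min hr0 (lt_min hθ (lt_min (by positivity) (lt_min (by positivity) (lt_min (by positivity) (lt_min (by positivity) (by positivity)))))),
    fun g b' c' hg hb' hc' hRb hcF ε s₁ b hε hεr hs₁ hs₁r hb hbh s₂ dom hB8 h3L => ?_⟩
  have hεr' : ε ≤ r := hεr.trans (min_le_left _ _)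
  have hεθ : ε ≤ θ := hεr.trans ((min_le_right _ _).trans (min_le_left _ _))
  have hεA : ε ≤ 1 / (A + 1) := hεr.trans ((min_le_right _ _).trans ((min_le_right _ _).trans (min_le_left _ _)))
  have hε1 : ε ≤ 3 / B₁ := hεr.trans ((min_le_right _ _).trans ((min_le_right _ _).trans ((min_le_right _ _).trans (min_le_left _ _))))
  have hε2 : ε ≤ (L : ℝ) ^ 2 / B₂ :=
    hεr.trans ((min_le_right _ _).trans ((min_le_right _ _).trans ((min_le_right _ _).trans ((min_le_right _ _).trans (min_le_left _ _)))))
  have hε3 : ε ≤ 1 / B₃ :=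
    hεr.trans ((min_le_right _ _).trans ((min_le_right _ _).trans ((min_le_right _ _).trans ((min_le_right _ _).trans ((min_le_right _ _).trans (min_le_left _ _))))))
  have hε4 : ε ≤ 2 / B₄ :=
    hεr.trans ((min_le_right _ _).trans ((min_le_right _ _).trans ((min_le_right _ _).trans ((min_le_right _ _).trans ((min_le_right _ _).trans (min_le_right _ _))))))
  have hs₁r' : s₁ ≤ r := hs₁r.trans (min_le_left _ _)
  -- the lines at this `ε`
  have hf1 : 16 * (14464 * ((d : ℝ) + 1) ^ 2 * ((d : ℝ) + 4) ^ 2) * ε ≤ 3 := by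
    rw [← hB₁]; rw [le_div_iff₀ hB₁0] at hε1; linarith
  have hf2 : 2 * twoLevelSmall d L * ε ≤ (L : ℝ) ^ 2 := by
    rw [← hB₂]; rw [le_div_iff₀ hB₂0] at hε2; linarith
  have hbs : 512 * (d + 1) * (d + 4) * (L : ℝ) ^ 2 * b ≤ 1 := by
    have h1' : B₃ * ε ≤ 1 := by rw [le_div_iff₀ hB₃0] at hε3; linarith
    have : B₃ * b ≤ B₃ * ε := mul_le_mul_of_nonneg_left (by linarith) hB₃0.le
    rw [hB₃] at this h1'
    linarith
  have hbε' : b + 226 * (8 * (d + 1) * (d + 4)) ^ 2 * b ^ 2 ≤ ε := by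
    have hB4ε : B₄ * ε ≤ 2 := by rw [le_div_iff₀ hB₄0] at hε4; linarith
    have hb2 : b ^ 2 ≤ (ε / 2) ^ 2 := pow_le_pow_left₀ hb hbh 2
    have : B₄ * b ^ 2 ≤ ε / 2 := by
      calc B₄ * b ^ 2 ≤ B₄ * (ε / 2) ^ 2 := mul_le_mul_of_nonneg_left hb2 hB₄0.le
        _ = (B₄ * ε) * ε / 4 := by ring
        _ ≤ 2 * ε / 4 := by
            have := mul_le_mul_of_nonneg_right hB4ε hε.le
            linarith
        _ = ε / 2 := by ring
    rw [hB₄] at this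
    linarith
  have h6 : 128 * (69 + 2 * ((2 + 32 * (8 * (Fintype.card n : ℝ) * d * (1 + 2 * (((d : ℝ) - 1) * θ)) ^ 2 * (2 * (8 : ℝ) ^ d) ^ 2))
              * (8 * (Fintype.card n : ℝ) * d * (1 + 2 * (((d : ℝ) - 1) * θ)) ^ 2 * (2 * (8 : ℝ) ^ d) ^ 2)))
        * CPLine d L (Fintype.card n) εc θ * (Fintype.card (Plane d) : ℝ) * (Fintype.card n : ℝ) * ε ^ 2 ≤ 1 := by
    rw [← hδW, ← hA]
    have hA1 : 0 < A + 1 := by linarith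
    have hεA' : ε * (A + 1) ≤ 1 := by rwa [le_div_iff₀ hA1] at hεA
    have hε1' : ε ≤ 1 := by
      have : ε ≤ ε * (A + 1) := le_mul_of_one_le_right hε.le (by linarith)
      linarith
    have t1 : A * ε * ε ≤ A * ε * 1 := mul_le_mul_of_nonneg_left hε1' (by positivity)
    have t2 : A * ε ≤ ε * (A + 1) := by linarith [hε.le]
    calc A * ε ^ 2 = A * ε * ε := by ring
      _ ≤ A * ε * 1 := t1
      _ = A * ε := by ring
      _ ≤ ε * (A + 1) := t2
      _ ≤ 1 := hεA'
  refine hr hg hb' hc' hRb hcF hε hεr' hs₁ hs₁r' hb hbh s₂ hB8 h3L ?_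
  intro j V _ UB _ hreg
  have hP := slicePoincare_slicB8_cavg_of_regular hd hL hN hb hε hεθ hεc hbs hbε' hf1 hf2 h1 h2 h3 h4 h6 j hreg
  rw [← hδW, ← hCP] at hP
  exact hP

/-- **THE END OF RECORD WITH NO NUMERIC LINE BUT THE TWO LEAF LINES, `r` UNIFORM IN `(g, b′, c′)`** (`3 ≤ d`, `2 ≤ L`, `1 ≤ N`): there is `r > 0` — a function
of `(d, L, N, n)` alone — such that for every `g > 0`, all leaf letters `0 ≤ b′, c′` on (Rb) and the `c′`-line, all `0 < ε ≤ r`, `0 ≤ s₁ ≤ r`, `0 ≤ b ≤ ε∕2`,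
every `s₂` and `dom`: `PairLandauGaugeB8Avg d (sfClass d L N ε) L N b g s₁ s₂ 1 dom` ∧ `LeafH3sup d L N ε b′ c′ dom` ⟹ `∃ C, NE3EnergyRateWCov d (sfClass d L N ε) L N b g C s₁ s₂ dom`
— §3 with `(θ, εc)` from `ownerLines_exist`; verbatim `…_lineFree` with the binders reordered. [folklore] -/
theorem ne3EnergyRateWCov_sfClass_small_lineFree_uniform [Nonempty n] (hd : 3 ≤ d) {L N : ℕ} [NeZero L] [NeZero N] (hL : 2 ≤ L)
    (hN : 1 ≤ N) :
    ∃ r : ℝ, 0 < r ∧ ∀ ⦃g b' c' : ℝ⦄, 0 < g → 0 ≤ b' → 0 ≤ c' →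
      2 ^ 15 * ((d : ℝ) + 1) ^ 2 * ((d : ℝ) + 4) ^ 2 * (L : ℝ) ^ 2 * b' ≤ 1 →
      23040 * (d : ℝ) ^ 4 * (frameC d L + d) ^ 3 * (c' + curConst d L * b' ^ 2) ≤ 1 → ∀ ⦃ε s₁ b : ℝ⦄, 0 < ε → ε ≤ r → 0 ≤ s₁ → s₁ ≤ r → 0 ≤ b → b ≤ ε / 2 →
      ∀ (s₂ : ℝ) {dom : _root_.Set (Site d → Fin d → (Matrix n n ℂ)ˣ)},
        PairLandauGaugeB8Avg d (sfClass d L N ε) L N b g s₁ s₂ 1 dom →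
        LeafH3sup d L N ε b' c' dom →
        ∃ C : ℝ, NE3EnergyRateWCov d (sfClass d L N ε) L N b g C s₁ s₂ dom := by
  obtain ⟨θ, εc, hθ, hεc, h1, h2, h3, h4⟩ := ownerLines_exist d (L := L) (by omega) (c := (Fintype.card n : ℝ)) (by positivity)
  exact ne3EnergyRateWCov_sfClass_small_of_lines_uniform hd hL hN hθ hεc h1 h2 h3 h4

/-! ## §4 The `d = 4` instance: g0's `n16_of_inEdges` with `∃ r` FIRST -/

/-- **N16 · NE3 BY NAME FROM ITS IN-EDGES, RADIUS FIRST** (`d = 4`; `L ≥ 2`, `N ≥ 1`): there is `r > 0` depending on `(L, N, n)` ONLY such that for every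
regularity letter `g > 0`, all leaf letters `0 ≤ b′, c′` on the two level-free lines (Rb) `2¹⁵·5²·8²·L²·b′ ≤ 1` and `23040·4⁴·(frameC 4 L + 4)³·(c′ + curConst·b′²) ≤ 1`,
every class radius `0 < ε ≤ r`, B8 constant `0 ≤ s₁ ≤ r`, regularity `0 ≤ b ≤ ε∕2`, every `s₂` and every datum set `dom`:
`PairLandauGaugeB8Avg 4 (sfClass 4 L N ε) L N b g s₁ s₂ 1 dom` (N05) and `LeafH3sup 4 L N ε b′ c′ dom` (N07) imply `∃ C, NE3EnergyRateWCov 4 (sfClass 4 L N ε) L N b g C s₁ s₂ dom`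
= `YMDAG.N16 L N ε b g C s₁ s₂ dom`.  g0's `n16_of_inEdges` verbatim but for the position of `∃ r`. [folklore] -/
theorem n16_of_inEdges_uniform [Nonempty n] {L N : ℕ} (hL : 2 ≤ L) (hN : 1 ≤ N) :
    ∃ r : ℝ, 0 < r ∧ ∀ ⦃g b' c' : ℝ⦄, 0 < g → 0 ≤ b' → 0 ≤ c' →
      2 ^ 15 * ((4 : ℝ) + 1) ^ 2 * ((4 : ℝ) + 4) ^ 2 * (L : ℝ) ^ 2 * b' ≤ 1 →
      23040 * (4 : ℝ) ^ 4 * (frameC 4 L + 4) ^ 3 * (c' + curConst 4 L * b' ^ 2) ≤ 1 →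
      ∀ ⦃ε s₁ b : ℝ⦄, 0 < ε → ε ≤ r → 0 ≤ s₁ → s₁ ≤ r → 0 ≤ b → b ≤ ε / 2 →
      ∀ (s₂ : ℝ) {dom : _root_.Set (Site 4 → Fin 4 → (Matrix n n ℂ)ˣ)},
        PairLandauGaugeB8Avg 4 (sfClass 4 L N ε) L N b g s₁ s₂ 1 dom →
        LeafH3sup 4 L N ε b' c' dom →
        ∃ C : ℝ, NE3EnergyRateWCov 4 (sfClass 4 L N ε) L N b g C s₁ s₂ dom := by
  haveI : NeZero L := NeZero.of_pos (by omega)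
  haveI : NeZero N := NeZero.of_pos (by omega)
  obtain ⟨r, hr0, hr⟩ := ne3EnergyRateWCov_sfClass_small_lineFree_uniform (d := 4) (n := n) (by norm_num) hL hN
  refine ⟨r, hr0, fun g b' c' hg hb' hc' hRb hcF => ?_⟩
  exact hr hg hb' hc' (by simpa only [Nat.cast_ofNat] using hRb) (by simpa only [Nat.cast_ofNat] using hcF)

end

end Summit.QuantumFields.YangMills.BalabanUVNodes.N16
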